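import Mathlib
import Summits.ValiantsHypothesis.ValiantsHypothesis.Theorems.NewtonTauWeak.Negative.Zonogon
import Summits.ValiantsHypothesis.ValiantsHypothesis.Theorems.NewtonUnitEquationsNewtonTauWeakSeparatedRank
import Summits.ValiantsHypothesis.ValiantsHypothesis.Theorems.NewtonUnitEquationsNewtonTauWeakVdpDefs
import Summits.ValiantsHypothesis.ValiantsHypothesis.Theorems.NewtonUnitEquationsNewtonTauWeakStubVertexCharts
import Summits.ValiantsHypothesis.ValiantsHypothesis.Theorems.NewtonUnitEquationsNewtonTauWeakStubChartPairCount
import Summits.ValiantsHypothesis.ValiantsHypothesis.Theorems.NewtonUnitEquationsNewtonTauWeakStubProductVertices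
import Summits.ValiantsHypothesis.ValiantsHypothesis.Theorems.NewtonUnitEquationsNewtonTauWeakHexagonPlanar
import Summits.ValiantsHypothesis.ValiantsHypothesis.Theorems.NewtonUnitEquationsNewtonTauWeakHexagonChartCount

/-!
# `NewtonUnitEquationsNewtonTauWeakHexagonChartCountRoots`

Rung toward `stub_binomialNewtonTauCommon` (T2 = KPTT Conj. 1 at `t = 2`; crux `NewtonTauWeak`,
stmt-ValiantsHypothesis-5904), line `binomial-normal-form`, lead c3: the ALL-`K` hexagon theorem `H_K`
("`vert(Σ_{l<K} X_l(x)Y_l(y)D_l(xy)) ≤ C(K)`, degree-free") via the HOMOGENEOUS Wronskian equation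
(card `Cruxes/NewtonTauWeak/Lines/binomial-normal-form-delta-global.md` §2).

This file: the ROOT-FORM CHART COUNT `hex_chart_count_roots` — the simplification of the landed `hex_chart_count` (…HexagonChartCount.lean) without the `W`-alternative: the chart tops of `F` are the `≤ 2` diagonal ones plus, for each chart top `z` of `U` and each of the `≤ n` roots `r` of `P_z`, the `≤ 2` tops on the anti-diagonal `v₀ - v₁ = r` (`HexagonThree.ncard_tops_line_complex_le_two`, `hex_ncard_tops_sub_eq_le_two`).

Conventions (inline, no definitions): `Δ` is ANY self-map of `ℂ[X,Y]` with `coeff e (Δ p) = (e₀ - e₁) · coeff e p`;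
"x-only" `∀ e ∈ P.support, e 1 = 0`, "y-only" `e 0 = 0`, "diagonal" `e 0 = e 1`; "separated of rank R":
`m = Σ_{r<R} P_r·Q_r` with `P_r` x-only, `Q_r` y-only. [folklore]
-/

set_option linter.dupNamespace false

noncomputable section

namespace Summit.ValiantsHypothesis.ValiantsHypothesis.Theorems.NewtonUnitEquationsNewtonTauWeak

open scoped BigOperators
open MvPolynomial
open Literature.Computability.AlgebraicComplexity (newtonVertexCount)
open Summit.ValiantsHypothesis.ValiantsHypothesis.Theorems.NewtonTauWeakVdp
open Summit.ValiantsHypothesis.ValiantsHypothesis.Theorems.NewtonTauWeak.Negative (vert)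

/-- H2 **Chart count, root form.** Along a chart `w_t = (σ, t)`: if every off-diagonal strict top `v` of `F` at a
generic time, together with the simultaneous strict top `z` of `U ≠ 0`, has `v₀ - v₁` among the roots of a nonzero
polynomial `P_z` of degree `≤ n`, then the chart tops of `F` number at most `2 + 2n·#(chart tops of U)`. [folklore] -/
theorem hex_chart_count_roots (σ : ℝ) (F U : MvPolynomial (Fin 2) ℂ) (n : ℕ)
    (Pz : (Fin 2 →₀ ℕ) → Polynomial ℂ) (hPz : ∀ z ∈ U.support, Pz z ≠ 0 ∧ (Pz z).natDegree ≤ n)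
    (hroot : ∀ t : ℝ, IsGeneric ![σ, t] → ∀ v z : Fin 2 →₀ ℕ, IsTop ![σ, t] F v → v 0 ≠ v 1 →
      IsTop ![σ, t] U z → (Pz z).IsRoot ((((v 0 : ℕ) : ℂ)) - ((v 1 : ℕ) : ℂ)))
    (hU : U ≠ 0) :
    {v : Fin 2 →₀ ℕ | ∃ t : ℝ, IsGeneric ![σ, t] ∧ IsTop ![σ, t] F v}.ncard ≤
      2 + 2 * n * {z : Fin 2 →₀ ℕ | ∃ t : ℝ, IsGeneric ![σ, t] ∧ IsTop ![σ, t] U z}.ncard := by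
  -- adapted from `hex_chart_count` (…HexagonChartCount.lean): same cover, no `B`-piece, `2n` roots per `z`
  classical
  set TU := {z : Fin 2 →₀ ℕ | ∃ t : ℝ, IsGeneric ![σ, t] ∧ IsTop ![σ, t] U z}
  have hTUfin : TU.Finite :=
    U.support.finite_toSet.subset fun z ⟨_, _, hz⟩ => Finset.mem_coe.mpr hz.mem
  -- the two pieces of the cover
  set Dg := {v : Fin 2 →₀ ℕ | (∃ w : Fin 2 → ℝ, IsTop w F v) ∧ ((v 0 : ℕ) : ℤ) - ((v 1 : ℕ) : ℤ) = 0}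
  set L : ℂ → Set (Fin 2 →₀ ℕ) := fun r =>
    {v | (∃ w : Fin 2 → ℝ, IsTop w F v) ∧ ((((v 0 : ℕ) : ℂ)) - ((v 1 : ℕ) : ℂ)) = r}
  set A := ⋃ z ∈ hTUfin.toFinset, ⋃ r ∈ (Pz z).roots.toFinset, L r with hA
  -- finiteness
  have hFfin : {v : Fin 2 →₀ ℕ | ∃ w : Fin 2 → ℝ, IsTop w F v}.Finite := ChartPairCount.tops_finite F
  have hDgfin : Dg.Finite := hFfin.subset fun v hv => hv.1
  have hLfin : ∀ r, (L r).Finite := fun r => hFfin.subset fun v hv => hv.1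
  have hAfin : A.Finite :=
    Set.Finite.biUnion (Finset.finite_toSet _) fun z _ =>
      Set.Finite.biUnion (Finset.finite_toSet _) fun r _ => hLfin r
  -- the cover
  have hcover : {v : Fin 2 →₀ ℕ | ∃ t : ℝ, IsGeneric ![σ, t] ∧ IsTop ![σ, t] F v} ⊆ Dg ∪ A := by
    rintro v ⟨t, ht, hv⟩
    by_cases hvv : v 0 = v 1
    · refine Or.inl ⟨⟨_, hv⟩, ?_⟩
      rw [hvv]; exact sub_self _
    · obtain ⟨z, hz⟩ := exists_isTop ht hU
      refine Or.inr ?_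
      rw [hA]
      refine Set.mem_iUnion₂.mpr ⟨z, (Set.Finite.mem_toFinset hTUfin).mpr ⟨t, ht, hz⟩, ?_⟩
      refine Set.mem_iUnion₂.mpr ⟨_, ?_, ⟨⟨_, hv⟩, rfl⟩⟩
      exact Multiset.mem_toFinset.mpr
        ((Polynomial.mem_roots (hPz z hz.mem).1).mpr (hroot t ht v z hv hvv hz))
  -- the bounds
  have hDle : Dg.ncard ≤ 2 := hex_ncard_tops_sub_eq_le_two F 0
  have hLle : ∀ r, (L r).ncard ≤ 2 := fun r => HexagonThree.ncard_tops_line_complex_le_two F r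
  have hAle : A.ncard ≤ 2 * n * TU.ncard := by
    rw [hA, Set.ncard_eq_toFinset_card TU hTUfin]
    refine (Finset.set_ncard_biUnion_le _ _).trans ?_
    have hz : ∀ z ∈ hTUfin.toFinset, (⋃ r ∈ (Pz z).roots.toFinset, L r).ncard ≤ 2 * n := by
      intro z hz
      have hzU : z ∈ U.support := by
        obtain ⟨t, -, h⟩ := (Set.Finite.mem_toFinset hTUfin).mp hz
        exact h.mem
      refine (Finset.set_ncard_biUnion_le _ _).trans ?_
      calc ∑ r ∈ (Pz z).roots.toFinset, (L r).ncard ≤ ∑ _r ∈ (Pz z).roots.toFinset, 2 :=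
            Finset.sum_le_sum fun r _ => hLle r
        _ = 2 * (Pz z).roots.toFinset.card := by rw [Finset.sum_const, smul_eq_mul, mul_comm]
        _ ≤ 2 * n := by
            gcongr
            exact (Multiset.toFinset_card_le _).trans
              ((Polynomial.card_roots' _).trans (hPz z hzU).2)
    calc ∑ z ∈ hTUfin.toFinset, (⋃ r ∈ (Pz z).roots.toFinset, L r).ncard
        ≤ ∑ _z ∈ hTUfin.toFinset, 2 * n := Finset.sum_le_sum hz
      _ = 2 * n * hTUfin.toFinset.card := by rw [Finset.sum_const, smul_eq_mul, mul_comm]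
  calc {v : Fin 2 →₀ ℕ | ∃ t : ℝ, IsGeneric ![σ, t] ∧ IsTop ![σ, t] F v}.ncard
      ≤ (Dg ∪ A).ncard := Set.ncard_le_ncard hcover (hDgfin.union hAfin)
    _ ≤ Dg.ncard + A.ncard := Set.ncard_union_le _ _
    _ ≤ 2 + 2 * n * TU.ncard := by gcongr


end Summit.ValiantsHypothesis.ValiantsHypothesis.Theorems.NewtonUnitEquationsNewtonTauWeak

end
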